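import Mathlib
import Summits.CriticalPhenomena.PercolationContinuityZ3.Theorems.PercNearOneGluingNoHeavyLowerTailOrientedAntipodalHallOuterOrderedSDR

/-!
# Theorem O for the strong tournament on four petals

Helper file for crux `stmt-CriticalPhenomena-4575` (`NoHeavyLowerTail`, route `PercNearOneGluingNoHeavy`),
new-inequality factory seat `prim-ineq-gen-3` (gen 12).  Everything here is PROVED.

Types `(i,j), (i,l), (j,l), (j,m), (l,m), (m,i)` — the Hamiltonian 4-cycle `i → j → l → m → i` with the chords `i → l`, `j → m` (the unique strongly connected tournament on four vertices).
Certificate (memo FINDINGS-gen11.md F11-7, verified by the label calculus of lab12/cert_ord_check.py; the rigidity theorem behind it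
is `ThreeFamilyRank.triple0_minus_ordered`, the count is `OrientedAntipodalHall.card_le_card_goods_above_of_outer_ordered_assignment`):
enlargement petal `τ = j`; ordered outer group `(D_{jl}ᶜ, 𝒴 ; D_{il}ᶜ)`, ordered middle group `(D_{mi}ᶜ ; D_{ij})`, outer group `D_{jm}ᶜ, D_{lm}ᶜ`.
With this file Conjecture O₄ — distinct good representatives above the antipodal bads of ANY opposite-free set of ordered types on four
petals — is a theorem for 39 of the 41 classes.  (prim-ineq-gen-3 gen 12, 2026-08-20.)
-/

namespace Summit.CriticalPhenomena.PercolationContinuityZ3.Theorems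

namespace OrientedAntipodalHall

open Finset AntipodalStrongHarris AntipodalStrongHarris.Lab
open scoped FinsetFamily

variable {α : Type*} [DecidableEq α] {k : ℕ}

/-- **Theorem O for the strong tournament on four petals.**  Types `(i,j), (i,l), (j,l), (j,m), (l,m), (m,i)` — the Hamiltonian 4-cycle `i → j → l → m → i` with the chords `i → l`, `j → m` (the unique strongly connected tournament on four vertices).  (Package: the count in grouped form and the system of distinct good representatives.) -/
theorem strongTournament_package (S : Finset α) {f : Finset α → Lab k}
    (hf : ∀ ⦃X Y : Finset α⦄, X ⊆ Y → f X ≤ f Y) (D₁ D₂ D₃ D₄ D₅ D₆ : Finset (Finset α)) {i j l m : Fin k}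
    (hij : i ≠ j) (hil : i ≠ l) (him : i ≠ m) (hjl : j ≠ l) (hjm : j ≠ m) (hlm : l ≠ m)
    (h1S : ∀ X ∈ D₁, X ⊆ S) (h1a : ∀ X ∈ D₁, f X = petal i) (h1b : ∀ X ∈ D₁, f (S \ X) = petal j)
    (h2S : ∀ X ∈ D₂, X ⊆ S) (h2a : ∀ X ∈ D₂, f X = petal i) (h2b : ∀ X ∈ D₂, f (S \ X) = petal l)
    (h3S : ∀ X ∈ D₃, X ⊆ S) (h3a : ∀ X ∈ D₃, f X = petal j) (h3b : ∀ X ∈ D₃, f (S \ X) = petal l)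
    (h4S : ∀ X ∈ D₄, X ⊆ S) (h4a : ∀ X ∈ D₄, f X = petal j) (h4b : ∀ X ∈ D₄, f (S \ X) = petal m)
    (h5S : ∀ X ∈ D₅, X ⊆ S) (h5a : ∀ X ∈ D₅, f X = petal l) (h5b : ∀ X ∈ D₅, f (S \ X) = petal m)
    (h6S : ∀ X ∈ D₆, X ⊆ S) (h6a : ∀ X ∈ D₆, f X = petal m) (h6b : ∀ X ∈ D₆, f (S \ X) = petal i)
    : #(D₂ ∪ D₃) + #(D₁ ∪ D₆) + #(D₄ ∪ D₅) ≤ #{U ∈ S.powerset | f U = top ∧ f (S \ U) = bot ∧ ∃ X ∈ ((D₂ ∪ D₃) ∪ (D₁ ∪ D₆) ∪ (D₄ ∪ D₅)), X ⊆ U} ∧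
      ∃ φ : ↥((D₂ ∪ D₃) ∪ (D₁ ∪ D₆) ∪ (D₄ ∪ D₅)) → Finset α, Function.Injective φ ∧
        ∀ X : ↥((D₂ ∪ D₃) ∪ (D₁ ∪ D₆) ∪ (D₄ ∪ D₅)), (X : Finset α) ⊆ φ X ∧ φ X ⊆ S ∧ f (φ X) = top ∧ f (S \ φ X) = bot := by
  have pinj : ∀ {p q : Fin k}, (petal p : Lab k) = petal q → p = q := fun h => Lab.petal.inj h
  have d12 : ∀ X ∈ D₁, X ∉ D₂ := fun X h1 h2 => hjl (pinj ((h1b X h1).symm.trans (h2b X h2)))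
  have d13 : ∀ X ∈ D₁, X ∉ D₃ := fun X h1 h2 => hij (pinj ((h1a X h1).symm.trans (h3a X h2)))
  have d14 : ∀ X ∈ D₁, X ∉ D₄ := fun X h1 h2 => hij (pinj ((h1a X h1).symm.trans (h4a X h2)))
  have d15 : ∀ X ∈ D₁, X ∉ D₅ := fun X h1 h2 => hil (pinj ((h1a X h1).symm.trans (h5a X h2)))
  have d16 : ∀ X ∈ D₁, X ∉ D₆ := fun X h1 h2 => him (pinj ((h1a X h1).symm.trans (h6a X h2)))
  have d23 : ∀ X ∈ D₂, X ∉ D₃ := fun X h1 h2 => hij (pinj ((h2a X h1).symm.trans (h3a X h2)))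
  have d24 : ∀ X ∈ D₂, X ∉ D₄ := fun X h1 h2 => hij (pinj ((h2a X h1).symm.trans (h4a X h2)))
  have d25 : ∀ X ∈ D₂, X ∉ D₅ := fun X h1 h2 => hil (pinj ((h2a X h1).symm.trans (h5a X h2)))
  have d26 : ∀ X ∈ D₂, X ∉ D₆ := fun X h1 h2 => him (pinj ((h2a X h1).symm.trans (h6a X h2)))
  have d34 : ∀ X ∈ D₃, X ∉ D₄ := fun X h1 h2 => hlm (pinj ((h3b X h1).symm.trans (h4b X h2)))
  have d35 : ∀ X ∈ D₃, X ∉ D₅ := fun X h1 h2 => hjl (pinj ((h3a X h1).symm.trans (h5a X h2)))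
  have d36 : ∀ X ∈ D₃, X ∉ D₆ := fun X h1 h2 => hjm (pinj ((h3a X h1).symm.trans (h6a X h2)))
  have d45 : ∀ X ∈ D₄, X ∉ D₅ := fun X h1 h2 => hjl (pinj ((h4a X h1).symm.trans (h5a X h2)))
  have d46 : ∀ X ∈ D₄, X ∉ D₆ := fun X h1 h2 => hjm (pinj ((h4a X h1).symm.trans (h6a X h2)))
  have d56 : ∀ X ∈ D₅, X ∉ D₆ := fun X h1 h2 => hlm (pinj ((h5a X h1).symm.trans (h6a X h2)))
  let cpl : Finset α → Bool := fun X => if X ∈ D₁ then false else if X ∈ D₂ then true else if X ∈ D₃ then true else if X ∈ D₄ then true else if X ∈ D₅ then true else true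
  let a : Finset α → Fin k := fun X => if X ∈ D₁ then i else if X ∈ D₂ then l else if X ∈ D₃ then l else if X ∈ D₄ then m else if X ∈ D₅ then m else i
  let b : Finset α → Fin k := fun X => if X ∈ D₁ then j else if X ∈ D₂ then i else if X ∈ D₃ then j else if X ∈ D₄ then j else if X ∈ D₅ then l else m
  have ev1 : ∀ X ∈ D₁, cpl X = false ∧ a X = i ∧ b X = j := by
    intro X hX
    simp [cpl, a, b, hX]
  have ev2 : ∀ X ∈ D₂, cpl X = true ∧ a X = l ∧ b X = i := by
    intro X hX
    have n1 : X ∉ D₁ := fun h => d12 X h hX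
    simp [cpl, a, b, hX, n1]
  have ev3 : ∀ X ∈ D₃, cpl X = true ∧ a X = l ∧ b X = j := by
    intro X hX
    have n1 : X ∉ D₁ := fun h => d13 X h hX
    have n2 : X ∉ D₂ := fun h => d23 X h hX
    simp [cpl, a, b, hX, n1, n2]
  have ev4 : ∀ X ∈ D₄, cpl X = true ∧ a X = m ∧ b X = j := by
    intro X hX
    have n1 : X ∉ D₁ := fun h => d14 X h hX
    have n2 : X ∉ D₂ := fun h => d24 X h hX
    have n3 : X ∉ D₃ := fun h => d34 X h hX
    simp [cpl, a, b, hX, n1, n2, n3]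
  have ev5 : ∀ X ∈ D₅, cpl X = true ∧ a X = m ∧ b X = l := by
    intro X hX
    have n1 : X ∉ D₁ := fun h => d15 X h hX
    have n2 : X ∉ D₂ := fun h => d25 X h hX
    have n3 : X ∉ D₃ := fun h => d35 X h hX
    have n4 : X ∉ D₄ := fun h => d45 X h hX
    simp [cpl, a, b, hX, n1, n2, n3, n4]
  have ev6 : ∀ X ∈ D₆, cpl X = true ∧ a X = i ∧ b X = m := by
    intro X hX
    have n1 : X ∉ D₁ := fun h => d16 X h hX
    have n2 : X ∉ D₂ := fun h => d26 X h hX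
    have n3 : X ∉ D₃ := fun h => d36 X h hX
    have n4 : X ∉ D₄ := fun h => d46 X h hX
    have n5 : X ∉ D₅ := fun h => d56 X h hX
    simp [cpl, a, b, n1, n2, n3, n4, n5]
  refine exists_injective_good_above_of_outer_ordered_assignment S hf (D₂ ∪ D₃) (D₁ ∪ D₆) (D₄ ∪ D₅) cpl a b j ?_ ?_ ?_ ?_ ?_ ?_ ?_ ?_ ?_ ?_ ?_ ?_ ?_
  · intro X hX
    simp only [mem_union] at hX
    rcases hX with ((hX | hX) | (hX | hX)) | (hX | hX)
    · obtain ⟨hc, ha, hb⟩ := ev2 X hX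
      refine ⟨h2S X hX, fun h => ?_, fun _ => ?_⟩
      · rw [hc] at h; exact absurd h (by decide)
      · rw [ha, hb]; exact ⟨h2b X hX, h2a X hX⟩
    · obtain ⟨hc, ha, hb⟩ := ev3 X hX
      refine ⟨h3S X hX, fun h => ?_, fun _ => ?_⟩
      · rw [hc] at h; exact absurd h (by decide)
      · rw [ha, hb]; exact ⟨h3b X hX, h3a X hX⟩
    · obtain ⟨hc, ha, hb⟩ := ev1 X hX
      refine ⟨h1S X hX, fun _ => ?_, fun h => ?_⟩
      · rw [ha, hb]; exact ⟨h1a X hX, h1b X hX⟩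
      · rw [hc] at h; exact absurd h (by decide)
    · obtain ⟨hc, ha, hb⟩ := ev6 X hX
      refine ⟨h6S X hX, fun h => ?_, fun _ => ?_⟩
      · rw [hc] at h; exact absurd h (by decide)
      · rw [ha, hb]; exact ⟨h6b X hX, h6a X hX⟩
    · obtain ⟨hc, ha, hb⟩ := ev4 X hX
      refine ⟨h4S X hX, fun h => ?_, fun _ => ?_⟩
      · rw [hc] at h; exact absurd h (by decide)
      · rw [ha, hb]; exact ⟨h4b X hX, h4a X hX⟩
    · obtain ⟨hc, ha, hb⟩ := ev5 X hX
      refine ⟨h5S X hX, fun h => ?_, fun _ => ?_⟩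
      · rw [hc] at h; exact absurd h (by decide)
      · rw [ha, hb]; exact ⟨h5b X hX, h5a X hX⟩
  · intro X hX
    simp only [mem_union] at hX
    rcases hX with ((hX | hX) | (hX | hX)) | (hX | hX)
    · obtain ⟨-, ha, -⟩ := ev2 X hX
      rw [ha]; exact hjl.symm
    · obtain ⟨-, ha, -⟩ := ev3 X hX
      rw [ha]; exact hjl.symm
    · obtain ⟨-, ha, -⟩ := ev1 X hX
      rw [ha]; exact hij
    · obtain ⟨-, ha, -⟩ := ev6 X hX
      rw [ha]; exact hij
    · obtain ⟨-, ha, -⟩ := ev4 X hX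
      rw [ha]; exact hjm.symm
    · obtain ⟨-, ha, -⟩ := ev5 X hX
      rw [ha]; exact hjm.symm
  · intro X hX
    simp only [mem_union] at hX
    rcases hX with hX | hX
    · exact (ev2 X hX).1
    · exact (ev3 X hX).1
  · intro X hX
    simp only [mem_union] at hX
    rcases hX with hX | hX
    · exact (ev4 X hX).1
    · exact (ev5 X hX).1
  · intro X hX X' hX'
    simp only [mem_union] at hX hX'
    rcases hX with hX | hX <;> rcases hX' with hX' | hX'
    · obtain ⟨hc, ha, hb⟩ := ev2 X hX; obtain ⟨hc', ha', hb'⟩ := ev2 X' hX'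
      rw [ha, hb, ha', hb']; exact ⟨hil.symm, hil⟩
    · obtain ⟨hc, ha, hb⟩ := ev2 X hX; obtain ⟨hc', ha', hb'⟩ := ev3 X' hX'
      rw [ha, hb, ha', hb']; exact ⟨hjl.symm, hil⟩
    · obtain ⟨hc, ha, hb⟩ := ev3 X hX; obtain ⟨hc', ha', hb'⟩ := ev2 X' hX'
      rw [ha, hb, ha', hb']; exact ⟨hil.symm, hjl⟩
    · obtain ⟨hc, ha, hb⟩ := ev3 X hX; obtain ⟨hc', ha', hb'⟩ := ev3 X' hX'
      rw [ha, hb, ha', hb']; exact ⟨hjl.symm, hjl⟩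
  · intro X hX X' hX'
    simp only [mem_union] at hX hX'
    rcases hX with hX | hX <;> rcases hX' with hX' | hX'
    · obtain ⟨hc, ha, hb⟩ := ev1 X hX; obtain ⟨hc', ha', hb'⟩ := ev1 X' hX'
      rw [ha, hb, ha', hb']; exact ⟨hij, hij.symm, fun h => by rw [hc] at h; exact absurd h (by decide)⟩
    · obtain ⟨hc, ha, hb⟩ := ev1 X hX; obtain ⟨hc', ha', hb'⟩ := ev6 X' hX'
      rw [ha, hb, ha', hb']; exact ⟨him, hij.symm, fun h => by rw [hc] at h; exact absurd h (by decide)⟩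
    · obtain ⟨hc, ha, hb⟩ := ev6 X hX; obtain ⟨hc', ha', hb'⟩ := ev1 X' hX'
      rw [ha, hb, ha', hb']; exact ⟨hij, him.symm, fun _ _ h => hjm.symm h.2⟩
    · obtain ⟨hc, ha, hb⟩ := ev6 X hX; obtain ⟨hc', ha', hb'⟩ := ev6 X' hX'
      rw [ha, hb, ha', hb']; exact ⟨him, him.symm, fun _ h => by rw [hc'] at h; exact absurd h (by decide)⟩
  · intro X hX X' hX'
    simp only [mem_union] at hX hX'
    rcases hX with hX | hX <;> rcases hX' with hX' | hX'
    · obtain ⟨hc, ha, hb⟩ := ev4 X hX; obtain ⟨hc', ha', hb'⟩ := ev4 X' hX'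
      rw [ha, hb, ha', hb']; exact ⟨hjm.symm, hjm⟩
    · obtain ⟨hc, ha, hb⟩ := ev4 X hX; obtain ⟨hc', ha', hb'⟩ := ev5 X' hX'
      rw [ha, hb, ha', hb']; exact ⟨hlm.symm, hjm⟩
    · obtain ⟨hc, ha, hb⟩ := ev5 X hX; obtain ⟨hc', ha', hb'⟩ := ev4 X' hX'
      rw [ha, hb, ha', hb']; exact ⟨hjm.symm, hlm⟩
    · obtain ⟨hc, ha, hb⟩ := ev5 X hX; obtain ⟨hc', ha', hb'⟩ := ev5 X' hX'
      rw [ha, hb, ha', hb']; exact ⟨hlm.symm, hlm⟩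
  · intro X hX Y hY
    simp only [mem_union] at hX hY
    rcases hX with hX | hX <;> rcases hY with hY | hY
    · obtain ⟨-, ha, hb⟩ := ev2 X hX; obtain ⟨-, ha', hb'⟩ := ev1 Y hY
      rw [ha, hb, ha', hb']; exact ⟨hil.symm, Or.inl hij, fun h => hjl.symm h.1⟩
    · obtain ⟨-, ha, hb⟩ := ev2 X hX; obtain ⟨-, ha', hb'⟩ := ev6 Y hY
      rw [ha, hb, ha', hb']; exact ⟨hil.symm, Or.inl him, fun h => hlm h.1⟩
    · obtain ⟨-, ha, hb⟩ := ev3 X hX; obtain ⟨-, ha', hb'⟩ := ev1 Y hY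
      rw [ha, hb, ha', hb']; exact ⟨hil.symm, Or.inr rfl, fun h => hjl.symm h.1⟩
    · obtain ⟨-, ha, hb⟩ := ev3 X hX; obtain ⟨-, ha', hb'⟩ := ev6 Y hY
      rw [ha, hb, ha', hb']; exact ⟨hil.symm, Or.inl hjm, fun h => hlm h.1⟩
  · intro X hX Y hY
    simp only [mem_union] at hX hY
    rcases hX with hX | hX <;> rcases hY with hY | hY
    · obtain ⟨-, ha, hb⟩ := ev1 X hX; obtain ⟨-, ha', hb'⟩ := ev4 Y hY
      rw [ha, hb, ha', hb']; exact ⟨him, Or.inr rfl, fun h => hij h.1⟩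
    · obtain ⟨-, ha, hb⟩ := ev1 X hX; obtain ⟨-, ha', hb'⟩ := ev5 Y hY
      rw [ha, hb, ha', hb']; exact ⟨him, Or.inl hjl, fun h => hil h.1⟩
    · obtain ⟨-, ha, hb⟩ := ev6 X hX; obtain ⟨-, ha', hb'⟩ := ev4 Y hY
      rw [ha, hb, ha', hb']; exact ⟨him, Or.inl hjm.symm, fun h => hij h.1⟩
    · obtain ⟨-, ha, hb⟩ := ev6 X hX; obtain ⟨-, ha', hb'⟩ := ev5 Y hY
      rw [ha, hb, ha', hb']; exact ⟨him, Or.inl hlm.symm, fun h => hil h.1⟩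
  · intro X hX Y hY
    simp only [mem_union] at hX hY
    rcases hX with hX | hX <;> rcases hY with hY | hY
    · obtain ⟨-, ha, hb⟩ := ev4 X hX; obtain ⟨-, ha', hb'⟩ := ev2 Y hY
      rw [ha, hb, ha', hb']; exact ⟨hlm.symm, Or.inl hij.symm, fun h => him.symm h.1⟩
    · obtain ⟨-, ha, hb⟩ := ev4 X hX; obtain ⟨-, ha', hb'⟩ := ev3 Y hY
      rw [ha, hb, ha', hb']; exact ⟨hlm.symm, Or.inr rfl, fun h => hjm.symm h.1⟩
    · obtain ⟨-, ha, hb⟩ := ev5 X hX; obtain ⟨-, ha', hb'⟩ := ev2 Y hY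
      rw [ha, hb, ha', hb']; exact ⟨hlm.symm, Or.inl hil.symm, fun h => him.symm h.1⟩
    · obtain ⟨-, ha, hb⟩ := ev5 X hX; obtain ⟨-, ha', hb'⟩ := ev3 Y hY
      rw [ha, hb, ha', hb']; exact ⟨hlm.symm, Or.inl hjl.symm, fun h => hjm.symm h.1⟩
  · intro X hX Y hY Z hZ
    simp only [mem_union] at hX hY hZ
    rcases hX with hX | hX <;> rcases hY with hY | hY <;> rcases hZ with hZ | hZ
    · obtain ⟨-, ha, hb⟩ := ev2 X hX; obtain ⟨-, -, hb'⟩ := ev1 Y hY; obtain ⟨-, -, hb''⟩ := ev4 Z hZ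
      rw [ha, hb, hb', hb'']; exact fun _ => fun h => hjl.symm h.1
    · obtain ⟨-, ha, hb⟩ := ev2 X hX; obtain ⟨-, -, hb'⟩ := ev1 Y hY; obtain ⟨-, -, hb''⟩ := ev5 Z hZ
      rw [ha, hb, hb', hb'']; exact fun _ => fun h => hjl.symm h.1
    · obtain ⟨-, ha, hb⟩ := ev2 X hX; obtain ⟨-, -, hb'⟩ := ev6 Y hY; obtain ⟨-, -, hb''⟩ := ev4 Z hZ
      rw [ha, hb, hb', hb'']; exact fun _ => fun h => hlm h.1
    · obtain ⟨-, ha, hb⟩ := ev2 X hX; obtain ⟨-, -, hb'⟩ := ev6 Y hY; obtain ⟨-, -, hb''⟩ := ev5 Z hZ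
      rw [ha, hb, hb', hb'']; exact fun _ => fun h => hlm h.1
    · obtain ⟨-, ha, hb⟩ := ev3 X hX; obtain ⟨-, -, hb'⟩ := ev1 Y hY; obtain ⟨-, -, hb''⟩ := ev4 Z hZ
      rw [ha, hb, hb', hb'']; exact fun _ => fun h => hjl.symm h.1
    · obtain ⟨-, ha, hb⟩ := ev3 X hX; obtain ⟨-, -, hb'⟩ := ev1 Y hY; obtain ⟨-, -, hb''⟩ := ev5 Z hZ
      rw [ha, hb, hb', hb'']; exact fun _ => fun h => hjl.symm h.1
    · obtain ⟨-, ha, hb⟩ := ev3 X hX; obtain ⟨-, -, hb'⟩ := ev6 Y hY; obtain ⟨-, -, hb''⟩ := ev4 Z hZ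
      rw [ha, hb, hb', hb'']; exact fun _ => fun h => hlm h.1
    · obtain ⟨-, ha, hb⟩ := ev3 X hX; obtain ⟨-, -, hb'⟩ := ev6 Y hY; obtain ⟨-, -, hb''⟩ := ev5 Z hZ
      rw [ha, hb, hb', hb'']; exact fun _ => fun h => hlm h.1
  · intro X hX Y hY Z hZ
    simp only [mem_union] at hX hY hZ
    rcases hX with hX | hX <;> rcases hY with hY | hY <;> rcases hZ with hZ | hZ
    · obtain ⟨-, ha, hb⟩ := ev2 X hX; obtain ⟨-, ha', hb'⟩ := ev1 Y hY; obtain ⟨-, ha'', hb''⟩ := ev4 Z hZ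
      rw [ha, hb, ha', hb', ha'', hb'']; exact ⟨fun h => him.symm h.1, fun h => hjl h.1⟩
    · obtain ⟨-, ha, hb⟩ := ev2 X hX; obtain ⟨-, ha', hb'⟩ := ev1 Y hY; obtain ⟨-, ha'', hb''⟩ := ev5 Z hZ
      rw [ha, hb, ha', hb', ha'', hb'']; exact ⟨fun h => him.symm h.1, fun h => hil.symm h.2⟩
    · obtain ⟨-, ha, hb⟩ := ev2 X hX; obtain ⟨-, ha', hb'⟩ := ev6 Y hY; obtain ⟨-, ha'', hb''⟩ := ev4 Z hZ
      rw [ha, hb, ha', hb', ha'', hb'']; exact ⟨fun h => him.symm h.1, fun h => hjl h.1⟩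
    · obtain ⟨-, ha, hb⟩ := ev2 X hX; obtain ⟨-, ha', hb'⟩ := ev6 Y hY; obtain ⟨-, ha'', hb''⟩ := ev5 Z hZ
      rw [ha, hb, ha', hb', ha'', hb'']; exact ⟨fun h => him.symm h.1, fun h => hil.symm h.2⟩
    · obtain ⟨-, ha, hb⟩ := ev3 X hX; obtain ⟨-, ha', hb'⟩ := ev1 Y hY; obtain ⟨-, ha'', hb''⟩ := ev4 Z hZ
      rw [ha, hb, ha', hb', ha'', hb'']; exact ⟨fun h => hjm.symm h.1, fun h => hjl h.1⟩
    · obtain ⟨-, ha, hb⟩ := ev3 X hX; obtain ⟨-, ha', hb'⟩ := ev1 Y hY; obtain ⟨-, ha'', hb''⟩ := ev5 Z hZ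
      rw [ha, hb, ha', hb', ha'', hb'']; exact ⟨fun h => hjm.symm h.1, fun h => hil.symm h.2⟩
    · obtain ⟨-, ha, hb⟩ := ev3 X hX; obtain ⟨-, ha', hb'⟩ := ev6 Y hY; obtain ⟨-, ha'', hb''⟩ := ev4 Z hZ
      rw [ha, hb, ha', hb', ha'', hb'']; exact ⟨fun h => hjm.symm h.1, fun h => hjl h.1⟩
    · obtain ⟨-, ha, hb⟩ := ev3 X hX; obtain ⟨-, ha', hb'⟩ := ev6 Y hY; obtain ⟨-, ha'', hb''⟩ := ev5 Z hZ
      rw [ha, hb, ha', hb', ha'', hb'']; exact ⟨fun h => hjm.symm h.1, fun h => hil.symm h.2⟩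
  · intro Y hY Z hZ
    simp only [mem_union] at hY hZ
    rcases hY with hY | hY <;> rcases hZ with hZ | hZ
    · obtain ⟨-, ha, -⟩ := ev1 Y hY; obtain ⟨-, -, hb'⟩ := ev4 Z hZ
      rw [ha, hb']; exact hij.symm
    · obtain ⟨-, ha, -⟩ := ev1 Y hY; obtain ⟨-, -, hb'⟩ := ev5 Z hZ
      rw [ha, hb']; exact hil.symm
    · obtain ⟨-, ha, -⟩ := ev6 Y hY; obtain ⟨-, -, hb'⟩ := ev4 Z hZ
      rw [ha, hb']; exact hij.symm
    · obtain ⟨-, ha, -⟩ := ev6 Y hY; obtain ⟨-, -, hb'⟩ := ev5 Z hZ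
      rw [ha, hb']; exact hil.symm

/-- **Theorem O for the strong tournament on four petals.**  Types `(i,j), (i,l), (j,l), (j,m), (l,m), (m,i)` — the Hamiltonian 4-cycle `i → j → l → m → i` with the chords `i → l`, `j → m` (the unique strongly connected tournament on four vertices).  (Count form: at least `#D₁ + ⋯ + #D₆` good sets contain a bad.) -/
theorem card_le_card_goods_above_strongTournament (S : Finset α) {f : Finset α → Lab k}
    (hf : ∀ ⦃X Y : Finset α⦄, X ⊆ Y → f X ≤ f Y) (D₁ D₂ D₃ D₄ D₅ D₆ : Finset (Finset α)) {i j l m : Fin k}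
    (hij : i ≠ j) (hil : i ≠ l) (him : i ≠ m) (hjl : j ≠ l) (hjm : j ≠ m) (hlm : l ≠ m)
    (h1S : ∀ X ∈ D₁, X ⊆ S) (h1a : ∀ X ∈ D₁, f X = petal i) (h1b : ∀ X ∈ D₁, f (S \ X) = petal j)
    (h2S : ∀ X ∈ D₂, X ⊆ S) (h2a : ∀ X ∈ D₂, f X = petal i) (h2b : ∀ X ∈ D₂, f (S \ X) = petal l)
    (h3S : ∀ X ∈ D₃, X ⊆ S) (h3a : ∀ X ∈ D₃, f X = petal j) (h3b : ∀ X ∈ D₃, f (S \ X) = petal l)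
    (h4S : ∀ X ∈ D₄, X ⊆ S) (h4a : ∀ X ∈ D₄, f X = petal j) (h4b : ∀ X ∈ D₄, f (S \ X) = petal m)
    (h5S : ∀ X ∈ D₅, X ⊆ S) (h5a : ∀ X ∈ D₅, f X = petal l) (h5b : ∀ X ∈ D₅, f (S \ X) = petal m)
    (h6S : ∀ X ∈ D₆, X ⊆ S) (h6a : ∀ X ∈ D₆, f X = petal m) (h6b : ∀ X ∈ D₆, f (S \ X) = petal i)
    : #D₁ + #D₂ + #D₃ + #D₄ + #D₅ + #D₆ ≤ #{U ∈ S.powerset | f U = top ∧ f (S \ U) = bot ∧ ∃ X ∈ D₁ ∪ D₂ ∪ D₃ ∪ D₄ ∪ D₅ ∪ D₆, X ⊆ U} := by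
  have hmain := (strongTournament_package S hf D₁ D₂ D₃ D₄ D₅ D₆ hij hil him hjl hjm hlm h1S h1a h1b h2S h2a h2b h3S h3a h3b h4S h4a h4b h5S h5a h5b h6S h6a h6b).1
  have pinj : ∀ {p q : Fin k}, (petal p : Lab k) = petal q → p = q := fun h => Lab.petal.inj h
  have d12 : ∀ X ∈ D₁, X ∉ D₂ := fun X h1 h2 => hjl (pinj ((h1b X h1).symm.trans (h2b X h2)))
  have d13 : ∀ X ∈ D₁, X ∉ D₃ := fun X h1 h2 => hij (pinj ((h1a X h1).symm.trans (h3a X h2)))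
  have d14 : ∀ X ∈ D₁, X ∉ D₄ := fun X h1 h2 => hij (pinj ((h1a X h1).symm.trans (h4a X h2)))
  have d15 : ∀ X ∈ D₁, X ∉ D₅ := fun X h1 h2 => hil (pinj ((h1a X h1).symm.trans (h5a X h2)))
  have d16 : ∀ X ∈ D₁, X ∉ D₆ := fun X h1 h2 => him (pinj ((h1a X h1).symm.trans (h6a X h2)))
  have d23 : ∀ X ∈ D₂, X ∉ D₃ := fun X h1 h2 => hij (pinj ((h2a X h1).symm.trans (h3a X h2)))
  have d24 : ∀ X ∈ D₂, X ∉ D₄ := fun X h1 h2 => hij (pinj ((h2a X h1).symm.trans (h4a X h2)))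
  have d25 : ∀ X ∈ D₂, X ∉ D₅ := fun X h1 h2 => hil (pinj ((h2a X h1).symm.trans (h5a X h2)))
  have d26 : ∀ X ∈ D₂, X ∉ D₆ := fun X h1 h2 => him (pinj ((h2a X h1).symm.trans (h6a X h2)))
  have d34 : ∀ X ∈ D₃, X ∉ D₄ := fun X h1 h2 => hlm (pinj ((h3b X h1).symm.trans (h4b X h2)))
  have d35 : ∀ X ∈ D₃, X ∉ D₅ := fun X h1 h2 => hjl (pinj ((h3a X h1).symm.trans (h5a X h2)))
  have d36 : ∀ X ∈ D₃, X ∉ D₆ := fun X h1 h2 => hjm (pinj ((h3a X h1).symm.trans (h6a X h2)))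
  have d45 : ∀ X ∈ D₄, X ∉ D₅ := fun X h1 h2 => hjl (pinj ((h4a X h1).symm.trans (h5a X h2)))
  have d46 : ∀ X ∈ D₄, X ∉ D₆ := fun X h1 h2 => hjm (pinj ((h4a X h1).symm.trans (h6a X h2)))
  have d56 : ∀ X ∈ D₅, X ∉ D₆ := fun X h1 h2 => hlm (pinj ((h5a X h1).symm.trans (h6a X h2)))
  have hU : (D₂ ∪ D₃) ∪ (D₁ ∪ D₆) ∪ (D₄ ∪ D₅) = D₁ ∪ D₂ ∪ D₃ ∪ D₄ ∪ D₅ ∪ D₆ := by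
    ext X; simp only [mem_union]; tauto
  rw [hU] at hmain
  have hc1 : #(D₂ ∪ D₃) = #D₂ + #D₃ := by
    rw [card_union_of_disjoint (Finset.disjoint_left.mpr (fun X hX hX2 => by
      exact d23 X hX hX2))]
  have hc2 : #(D₁ ∪ D₆) = #D₁ + #D₆ := by
    rw [card_union_of_disjoint (Finset.disjoint_left.mpr (fun X hX hX2 => by
      exact d16 X hX hX2))]
  have hc3 : #(D₄ ∪ D₅) = #D₄ + #D₅ := by
    rw [card_union_of_disjoint (Finset.disjoint_left.mpr (fun X hX hX2 => by
      exact d45 X hX hX2))]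
  rw [hc1, hc2, hc3] at hmain
  omega

/-- **Theorem O for the strong tournament on four petals.**  Types `(i,j), (i,l), (j,l), (j,m), (l,m), (m,i)` — the Hamiltonian 4-cycle `i → j → l → m → i` with the chords `i → l`, `j → m` (the unique strongly connected tournament on four vertices).  (Hall form: the bads admit DISTINCT good representatives above them; the domain is the union of the six families, grouped as in the certificate.) -/
theorem exists_injective_good_above_strongTournament (S : Finset α) {f : Finset α → Lab k}
    (hf : ∀ ⦃X Y : Finset α⦄, X ⊆ Y → f X ≤ f Y) (D₁ D₂ D₃ D₄ D₅ D₆ : Finset (Finset α)) {i j l m : Fin k}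
    (hij : i ≠ j) (hil : i ≠ l) (him : i ≠ m) (hjl : j ≠ l) (hjm : j ≠ m) (hlm : l ≠ m)
    (h1S : ∀ X ∈ D₁, X ⊆ S) (h1a : ∀ X ∈ D₁, f X = petal i) (h1b : ∀ X ∈ D₁, f (S \ X) = petal j)
    (h2S : ∀ X ∈ D₂, X ⊆ S) (h2a : ∀ X ∈ D₂, f X = petal i) (h2b : ∀ X ∈ D₂, f (S \ X) = petal l)
    (h3S : ∀ X ∈ D₃, X ⊆ S) (h3a : ∀ X ∈ D₃, f X = petal j) (h3b : ∀ X ∈ D₃, f (S \ X) = petal l)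
    (h4S : ∀ X ∈ D₄, X ⊆ S) (h4a : ∀ X ∈ D₄, f X = petal j) (h4b : ∀ X ∈ D₄, f (S \ X) = petal m)
    (h5S : ∀ X ∈ D₅, X ⊆ S) (h5a : ∀ X ∈ D₅, f X = petal l) (h5b : ∀ X ∈ D₅, f (S \ X) = petal m)
    (h6S : ∀ X ∈ D₆, X ⊆ S) (h6a : ∀ X ∈ D₆, f X = petal m) (h6b : ∀ X ∈ D₆, f (S \ X) = petal i)
    : ∃ φ : ↥((D₂ ∪ D₃) ∪ (D₁ ∪ D₆) ∪ (D₄ ∪ D₅)) → Finset α, Function.Injective φ ∧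
        ∀ X : ↥((D₂ ∪ D₃) ∪ (D₁ ∪ D₆) ∪ (D₄ ∪ D₅)), (X : Finset α) ⊆ φ X ∧ φ X ⊆ S ∧ f (φ X) = top ∧ f (S \ φ X) = bot :=
  (strongTournament_package S hf D₁ D₂ D₃ D₄ D₅ D₆ hij hil him hjl hjm hlm h1S h1a h1b h2S h2a h2b h3S h3a h3b h4S h4a h4b h5S h5a h5b h6S h6a h6b).2
end OrientedAntipodalHall

end Summit.CriticalPhenomena.PercolationContinuityZ3.Theorems
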